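import Summits.AnomalousDissipation.AnomalousDissipation.Theorems.SawtoothPulseCascadeApproxSlotStepV
import Literature.Analysis.FluidPDE.TorusLinearisedNSShearModesSuperposition

/-!
# Slot-wise Duhamel decomposition of the forced linearised response
(route `AnomalousDissipation/SawtoothPulseCascade`; helper for the crux ApproxSol58 =
stmt-AnomalousDissipation-19688, registered stub `stub_responseL2` / S1 `stub_responseL2Envelope`:
the realignment pipeline, global level)

Index the half-slots by `k ∈ ℕ` (phase `k/2`, H half for even `k`, V half for odd `k`); slot `k` is
`[σ k, σ (k+1)]` with `σ k = tInject (k/2) (k even)`.  Let `(L, q)` be the classical forced linearised response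
on `[0, T']` from zero, `g k` the realigned comb profiles of `…ApproxRealign` and `W k` classical
HOMOGENEOUS solutions on `[σ k, T']` started from `g k` (as fields parallel to the pulse of slot `k`).  Then
for every slot `k < K` (`σ K ≤ T'`):

* `L(σ k) = Σ_{i<k} W i (σ k)` (induction over the slots with `slot_split_H/V`, `slot_end_H/V`,
  linearity `Torus.linearisedNS_finset_sum` and uniqueness);
* for `t` in slot `k`: `√∫‖L(t)‖² ≤ Σ_{i<k} √∫‖W i (t)‖² + 6√(2π) ν N_{k/2} γ / δ_{k/2}`.

K2″ bounds each `W i` (next file).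
-/

set_option linter.dupNamespace false

noncomputable section

namespace Summit.AnomalousDissipation.AnomalousDissipation.Theorems.SawtoothPulseCascade.ApproxResponse

open Set MeasureTheory
open scoped ContDiff InnerProductSpace
open Literature.Analysis Literature.Analysis.FunctionSpaces Literature.Analysis.FluidPDE
open Literature.Analysis.FluidPDE.SawtoothCascade
open Literature.Analysis.FluidPDE.SawtoothCascade.CascadeParams
open Summit.AnomalousDissipation.AnomalousDissipation.Theorems.SawtoothPulseCascade.K2Classical

/-! ## §1 The slot clock `σ k = tInject (k/2) (k even)` -/

/-- Slot `2j` starts at `tStart j`. -/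
theorem slotStart_even (j : ℕ) : CascadeParams.tInject ((2 * j) / 2) ((2 * j) % 2 == 0) = tStart j := by
  have h1 : (2 * j) / 2 = j := by omega
  have h2 : ((2 * j) % 2 == 0) = true := by simp
  rw [h1, h2]
  simp [CascadeParams.tInject]

/-- Slot `2j + 1` starts at `tStart j + tHalf j`. -/
theorem slotStart_odd (j : ℕ) :
    CascadeParams.tInject ((2 * j + 1) / 2) ((2 * j + 1) % 2 == 0) = tStart j + tHalf j := by
  have h1 : (2 * j + 1) / 2 = j := by omega
  have h2 : ((2 * j + 1) % 2 == 0) = false := by simp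
  rw [h1, h2]
  simp [CascadeParams.tInject]

/-- Slot `2j + 1` ends at `tStart (j+1)`. -/
theorem slotStart_odd_succ (j : ℕ) :
    CascadeParams.tInject ((2 * j + 1 + 1) / 2) ((2 * j + 1 + 1) % 2 == 0) = tStart (j + 1) := by
  rw [show 2 * j + 1 + 1 = 2 * (j + 1) by ring]
  exact slotStart_even (j + 1)

/-- Slot `2j` ends at `tStart j + tHalf j`. -/
theorem slotStart_even_succ (j : ℕ) :
    CascadeParams.tInject ((2 * j + 1) / 2) ((2 * j + 1) % 2 == 0) = tStart j + tHalf j := slotStart_odd j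

/-- The slot clock advances by `tHalf (k/2)` per slot. -/
theorem slotStart_succ (k : ℕ) :
    CascadeParams.tInject ((k + 1) / 2) ((k + 1) % 2 == 0) = CascadeParams.tInject (k / 2) (k % 2 == 0) + tHalf (k / 2) := by
  obtain ⟨j, rfl | rfl⟩ := Nat.even_or_odd' k
  · rw [slotStart_even_succ, slotStart_even, show 2 * j / 2 = j by omega]
  · rw [slotStart_odd_succ, slotStart_odd, show (2 * j + 1) / 2 = j by omega, tStart_succ]
    ring

/-- The slot clock is monotone. -/
theorem slotStart_mono : Monotone fun k : ℕ => CascadeParams.tInject (k / 2) (k % 2 == 0) := by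
  refine monotone_nat_of_le_succ fun k => ?_
  show CascadeParams.tInject (k / 2) (k % 2 == 0) ≤ CascadeParams.tInject ((k + 1) / 2) ((k + 1) % 2 == 0)
  rw [slotStart_succ]
  linarith [tHalf_pos (k / 2)]

/-- The slot clock starts at `0`. -/
theorem slotStart_zero : CascadeParams.tInject (0 / 2) (0 % 2 == 0) = 0 := by
  have := slotStart_even 0
  simp only [mul_zero] at this
  rw [this]
  rfl

/-- Every slot start is in `[0, 1)`. -/
theorem slotStart_nonneg (k : ℕ) : 0 ≤ CascadeParams.tInject (k / 2) (k % 2 == 0) :=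
  (CascadeParams.tInject_mem_Ico _ _).1


/-- Slots are non-degenerate. -/
theorem slotStart_lt_succ (k : ℕ) :
    CascadeParams.tInject (k / 2) (k % 2 == 0) < CascadeParams.tInject ((k + 1) / 2) ((k + 1) % 2 == 0) := by
  rw [slotStart_succ]; linarith [tHalf_pos (k / 2)]

/-! ## §2 The partial sums of the realigned pieces are homogeneous solutions on later slots -/

section Duhamel

variable (P : CascadeParams) {ν T' : ℝ} {K : ℕ}
  {W : ℕ → ℝ → UnitAddTorus (Fin 2) → EuclideanSpace ℝ (Fin 2)} {R : ℕ → ℝ → UnitAddTorus (Fin 2) → ℝ}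

/-- **Partial sums of the pieces.** If each `(W i, R i)`, `i < K`, is a classical homogeneous linearised
solution on `[σ i, T']`, then for `k < K` with `σ (k+1) ≤ T'` the partial sum `Σ_{i<k} W i` (with pressure
`Σ_{i<k} R i`) is a classical homogeneous solution on slot `k`. -/
theorem partialSum_linearisedNS
    (hW : ∀ i < K, Torus.IsSmoothSpaceTimeOn (Icc (CascadeParams.tInject (i / 2) (i % 2 == 0)) T') (W i))
    (hR : ∀ i < K, Torus.IsSmoothSpaceTimeOn (Icc (CascadeParams.tInject (i / 2) (i % 2 == 0)) T') (R i))
    (hWdiv : ∀ i < K, ∀ t ∈ Icc (CascadeParams.tInject (i / 2) (i % 2 == 0)) T', Torus.IsDivFree (W i t))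
    (hWlin : ∀ i < K, ∀ t ∈ Icc (CascadeParams.tInject (i / 2) (i % 2 == 0)) T', ∀ x,
      Torus.timeDerivWithin (Icc (CascadeParams.tInject (i / 2) (i % 2 == 0)) T') (W i) t x +
        Torus.convect (P.field t) (W i t) x + Torus.convect (W i t) (P.field t) x =
          ν • Torus.laplacian (W i t) x - Torus.gradient (R i t) x)
    {k : ℕ} (hk : k < K) (hkT : CascadeParams.tInject ((k + 1) / 2) ((k + 1) % 2 == 0) ≤ T') :
    Torus.IsSmoothSpaceTimeOn (Icc (CascadeParams.tInject (k / 2) (k % 2 == 0))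
        (CascadeParams.tInject ((k + 1) / 2) ((k + 1) % 2 == 0))) (fun t y => ∑ i ∈ Finset.range k, W i t y) ∧
      Torus.IsSmoothSpaceTimeOn (Icc (CascadeParams.tInject (k / 2) (k % 2 == 0))
        (CascadeParams.tInject ((k + 1) / 2) ((k + 1) % 2 == 0))) (fun t y => ∑ i ∈ Finset.range k, R i t y) ∧
      (∀ t ∈ Icc (CascadeParams.tInject (k / 2) (k % 2 == 0)) (CascadeParams.tInject ((k + 1) / 2) ((k + 1) % 2 == 0)),
        Torus.IsDivFree (fun y => ∑ i ∈ Finset.range k, W i t y)) ∧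
      (∀ t ∈ Icc (CascadeParams.tInject (k / 2) (k % 2 == 0)) (CascadeParams.tInject ((k + 1) / 2) ((k + 1) % 2 == 0)),
        ∀ x, Torus.timeDerivWithin (Icc (CascadeParams.tInject (k / 2) (k % 2 == 0))
            (CascadeParams.tInject ((k + 1) / 2) ((k + 1) % 2 == 0))) (fun t y => ∑ i ∈ Finset.range k, W i t y) t x +
          Torus.convect (P.field t) (fun y => ∑ i ∈ Finset.range k, W i t y) x +
          Torus.convect (fun y => ∑ i ∈ Finset.range k, W i t y) (P.field t) x =
            ν • Torus.laplacian (fun y => ∑ i ∈ Finset.range k, W i t y) x -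
              Torus.gradient (fun y => ∑ i ∈ Finset.range k, R i t y) x) := by
  set a := CascadeParams.tInject (k / 2) (k % 2 == 0) with ha_def
  set b := CascadeParams.tInject ((k + 1) / 2) ((k + 1) % 2 == 0) with hb_def
  have hab : a < b := slotStart_lt_succ k
  -- restriction of each earlier piece to slot `k`
  have hsub : ∀ i < k, Icc a b ⊆ Icc (CascadeParams.tInject (i / 2) (i % 2 == 0)) T' := fun i hi s hs =>
    ⟨(slotStart_mono hi.le).trans hs.1, hs.2.trans hkT⟩
  have hW' : ∀ i ∈ Finset.range k, Torus.IsSmoothSpaceTimeOn (Icc a b) (W i) := fun i hi =>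
    (hW i ((Finset.mem_range.1 hi).trans hk)).mono (hsub i (Finset.mem_range.1 hi))
  have hR' : ∀ i ∈ Finset.range k, Torus.IsSmoothSpaceTimeOn (Icc a b) (R i) := fun i hi =>
    (hR i ((Finset.mem_range.1 hi).trans hk)).mono (hsub i (Finset.mem_range.1 hi))
  have hWdiv' : ∀ i ∈ Finset.range k, ∀ t ∈ Icc a b, Torus.IsDivFree (W i t) := fun i hi t ht =>
    hWdiv i ((Finset.mem_range.1 hi).trans hk) t (hsub i (Finset.mem_range.1 hi) ht)
  have hWlin' : ∀ i ∈ Finset.range k, ∀ t ∈ Icc a b, ∀ x,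
      Torus.timeDerivWithin (Icc a b) (W i) t x + Torus.convect (P.field t) (W i t) x +
        Torus.convect (W i t) (P.field t) x = ν • Torus.laplacian (W i t) x - Torus.gradient (R i t) x := by
    intro i hi t ht x
    have hi' := Finset.mem_range.1 hi
    rw [timeDerivWithin_Icc_eq_of_subset hab (hsub i hi') (hW i (hi'.trans hk)) ht x]
    exact hWlin i (hi'.trans hk) t (hsub i hi' ht) x
  rcases Nat.eq_zero_or_pos k with hk0 | hkpos
  · -- empty sum: the zero field, written as `0 • W 0`
    subst hk0
    have h0W := hW 0 hk
    have h0R := hR 0 hk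
    have hsub0 : Icc a b ⊆ Icc (CascadeParams.tInject (0 / 2) (0 % 2 == 0)) T' := fun s hs => ⟨hs.1, hs.2.trans hkT⟩
    have hWs := h0W.mono hsub0
    have hRs := h0R.mono hsub0
    have hlin0 : ∀ t ∈ Icc a b, ∀ x, Torus.timeDerivWithin (Icc a b) (W 0) t x + Torus.convect (P.field t) (W 0 t) x +
        Torus.convect (W 0 t) (P.field t) x = ν • Torus.laplacian (W 0 t) x - Torus.gradient (R 0 t) x := by
      intro t ht x
      rw [timeDerivWithin_Icc_eq_of_subset hab hsub0 h0W ht x]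
      exact hWlin 0 hk t (hsub0 ht) x
    have e1 : (fun t (y : UnitAddTorus (Fin 2)) => ∑ i ∈ Finset.range 0, W i t y) = fun t y => (0 : ℝ) • W 0 t y := by
      funext t y; simp
    have e2 : (fun t (y : UnitAddTorus (Fin 2)) => ∑ i ∈ Finset.range 0, R i t y) = fun t y => (0 : ℝ) • R 0 t y := by
      funext t y; simp
    have e3 : ∀ t, (fun (y : UnitAddTorus (Fin 2)) => ∑ i ∈ Finset.range 0, W i t y) = fun y => (0 : ℝ) • W 0 t y := by
      intro t; funext y; simp
    have e4 : ∀ t, (fun (y : UnitAddTorus (Fin 2)) => ∑ i ∈ Finset.range 0, R i t y) = fun y => (0 : ℝ) • R 0 t y := by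
      intro t; funext y; simp
    refine ⟨?_, ?_, fun t ht => ?_, fun t ht x => ?_⟩
    · rw [e1]; exact hWs.const_smul 0
    · rw [e2]; exact hRs.const_smul 0
    · rw [e3]
      intro x
      rw [show (fun y => (0 : ℝ) • W 0 t y) = (0 : ℝ) • W 0 t from rfl,
        Torus.divergence_const_smul_of_isSmooth (hWs.isSmooth_slice ht) 0 x, zero_mul]
    · rw [e1, e3, e4]
      exact Torus.linearisedNS_const_smul hab hWs hRs hlin0 0 ht x
  · have hne : (Finset.range k).Nonempty := Finset.nonempty_range_iff.2 (Nat.pos_iff_ne_zero.1 hkpos)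
    exact Torus.linearisedNS_finset_sum hab hne hW' hR' hWdiv' hWlin'


/-! ## §3 The induction over the slots -/

/-- **What has entered slot `k`.**  `L(σ k) = Σ_{i<k} W i (σ k)` for every `k ≤ K` (`σ K ≤ T'`): the forced
response at the start of slot `k` is the superposition of the realigned pieces of the earlier slots. -/
theorem response_at_slotStart (hδ₀ : 0 < P.δ₀) (hd : 0 < P.d) (hγ : 0 ≤ P.γ) (hN : ∀ j, P.N j ≠ 0)
    (hν : 0 < ν) (hK : CascadeParams.tInject (K / 2) (K % 2 == 0) ≤ T')
    {L : ℝ → UnitAddTorus (Fin 2) → EuclideanSpace ℝ (Fin 2)} {q : ℝ → UnitAddTorus (Fin 2) → ℝ}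
    (hL : Torus.IsSmoothSpaceTimeOn (Icc 0 T') L) (hq : Torus.IsSmoothSpaceTimeOn (Icc 0 T') q)
    (hLdiv : ∀ t ∈ Icc 0 T', Torus.IsDivFree (L t)) (hL0 : L 0 = fun _ => 0)
    (hlin : ∀ t ∈ Icc 0 T', ∀ x, Torus.timeDerivWithin (Icc 0 T') L t x + Torus.convect (P.field t) (L t) x +
      Torus.convect (L t) (P.field t) x =
        ν • Torus.laplacian (L t) x - Torus.gradient (q t) x + ν • Torus.laplacian (P.field t) x)
    {g : ℕ → ℝ → ℝ} (hg : ∀ k < K, ContDiff ℝ ∞ (g k) ∧ Function.Periodic (g k) 1)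
    (hrealH : ∀ j, 2 * j < K → ∀ c F : ℝ → ℝ → ℝ,
        ContDiffOn ℝ ∞ (Function.uncurry c) (Icc (tStart j) (tStart j + tHalf j) ×ˢ univ) →
        (∀ t ∈ Icc (tStart j) (tStart j + tHalf j), Function.Periodic (c t) 1) →
        (∀ t ∈ Icc (tStart j) (tStart j + tHalf j), ∀ y,
          derivWithin (fun s => c s y) (Icc (tStart j) (tStart j + tHalf j)) t = ν * deriv (deriv (c t)) y) →
        c (tStart j) = g (2 * j) →
        ContDiffOn ℝ ∞ (Function.uncurry F) (Icc (tStart j) (tStart j + tHalf j) ×ˢ univ) →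
        (∀ t ∈ Icc (tStart j) (tStart j + tHalf j), Function.Periodic (F t) 1) → F (tStart j) = (fun _ => 0) →
        (∀ t ∈ Icc (tStart j) (tStart j + tHalf j), ∀ y,
          derivWithin (fun s => F s y) (Icc (tStart j) (tStart j + tHalf j)) t =
            ν * deriv (deriv (F t)) y + ν * (P.rateH j t * deriv (deriv (P.U j)) y)) →
        c (tStart j + tHalf j) = F (tStart j + tHalf j))
    (hrealV : ∀ j, 2 * j + 1 < K → ∀ c F : ℝ → ℝ → ℝ,
        ContDiffOn ℝ ∞ (Function.uncurry c) (Icc (tStart j + tHalf j) (tStart (j + 1)) ×ˢ univ) →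
        (∀ t ∈ Icc (tStart j + tHalf j) (tStart (j + 1)), Function.Periodic (c t) 1) →
        (∀ t ∈ Icc (tStart j + tHalf j) (tStart (j + 1)), ∀ y,
          derivWithin (fun s => c s y) (Icc (tStart j + tHalf j) (tStart (j + 1))) t = ν * deriv (deriv (c t)) y) →
        c (tStart j + tHalf j) = g (2 * j + 1) →
        ContDiffOn ℝ ∞ (Function.uncurry F) (Icc (tStart j + tHalf j) (tStart (j + 1)) ×ˢ univ) →
        (∀ t ∈ Icc (tStart j + tHalf j) (tStart (j + 1)), Function.Periodic (F t) 1) →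
        F (tStart j + tHalf j) = (fun _ => 0) →
        (∀ t ∈ Icc (tStart j + tHalf j) (tStart (j + 1)), ∀ y,
          derivWithin (fun s => F s y) (Icc (tStart j + tHalf j) (tStart (j + 1))) t =
            ν * deriv (deriv (F t)) y + ν * (P.rateV j t * deriv (deriv (P.U j)) y)) →
        c (tStart (j + 1)) = F (tStart (j + 1)))
    (hW : ∀ i < K, Torus.IsSmoothSpaceTimeOn (Icc (CascadeParams.tInject (i / 2) (i % 2 == 0)) T') (W i))
    (hR : ∀ i < K, Torus.IsSmoothSpaceTimeOn (Icc (CascadeParams.tInject (i / 2) (i % 2 == 0)) T') (R i))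
    (hWdiv : ∀ i < K, ∀ t ∈ Icc (CascadeParams.tInject (i / 2) (i % 2 == 0)) T', Torus.IsDivFree (W i t))
    (hWlin : ∀ i < K, ∀ t ∈ Icc (CascadeParams.tInject (i / 2) (i % 2 == 0)) T', ∀ x,
      Torus.timeDerivWithin (Icc (CascadeParams.tInject (i / 2) (i % 2 == 0)) T') (W i) t x +
        Torus.convect (P.field t) (W i t) x + Torus.convect (W i t) (P.field t) x =
          ν • Torus.laplacian (W i t) x - Torus.gradient (R i t) x)
    (hW0H : ∀ j, 2 * j < K → W (2 * j) (tStart j) =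
      fun x => g (2 * j) (Torus.repr x 1) • EuclideanSpace.single (0 : Fin 2) (1 : ℝ))
    (hW0V : ∀ j, 2 * j + 1 < K → W (2 * j + 1) (tStart j + tHalf j) =
      fun x => g (2 * j + 1) (Torus.repr x 0) • EuclideanSpace.single (1 : Fin 2) (1 : ℝ)) :
    ∀ k ≤ K, L (CascadeParams.tInject (k / 2) (k % 2 == 0)) =
      fun x => ∑ i ∈ Finset.range k, W i (CascadeParams.tInject (k / 2) (k % 2 == 0)) x := by
  intro k
  induction k with
  | zero =>
    intro _
    rw [slotStart_zero, hL0]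
    funext x
    simp
  | succ k ih =>
    intro hk1
    have hk : k < K := hk1
    have hkT : CascadeParams.tInject ((k + 1) / 2) ((k + 1) % 2 == 0) ≤ T' := (slotStart_mono hk1).trans hK
    have hclaim := ih hk.le
    obtain ⟨hS, hQ, hSdiv, hSlin⟩ := partialSum_linearisedNS P hW hR hWdiv hWlin hk hkT
    -- the piece of slot `k`, restricted to slot `k`
    have hab := slotStart_lt_succ k
    have hsubk : Icc (CascadeParams.tInject (k / 2) (k % 2 == 0)) (CascadeParams.tInject ((k + 1) / 2) ((k + 1) % 2 == 0))
        ⊆ Icc (CascadeParams.tInject (k / 2) (k % 2 == 0)) T' := fun s hs => ⟨hs.1, hs.2.trans hkT⟩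
    have hWk := (hW k hk).mono hsubk
    have hRk := (hR k hk).mono hsubk
    have hWkdiv : ∀ t ∈ Icc (CascadeParams.tInject (k / 2) (k % 2 == 0))
        (CascadeParams.tInject ((k + 1) / 2) ((k + 1) % 2 == 0)), Torus.IsDivFree (W k t) :=
      fun t ht => hWdiv k hk t (hsubk ht)
    have hWklin : ∀ t ∈ Icc (CascadeParams.tInject (k / 2) (k % 2 == 0))
        (CascadeParams.tInject ((k + 1) / 2) ((k + 1) % 2 == 0)), ∀ x,
        Torus.timeDerivWithin (Icc (CascadeParams.tInject (k / 2) (k % 2 == 0))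
          (CascadeParams.tInject ((k + 1) / 2) ((k + 1) % 2 == 0))) (W k) t x +
          Torus.convect (P.field t) (W k t) x + Torus.convect (W k t) (P.field t) x =
            ν • Torus.laplacian (W k t) x - Torus.gradient (R k t) x := by
      intro t ht x
      rw [timeDerivWithin_Icc_eq_of_subset hab hsubk (hW k hk) ht x]
      exact hWlin k hk t (hsubk ht) x
    obtain ⟨j, rfl | rfl⟩ := Nat.even_or_odd' k
    · -- H half-slot of phase `j`
      rw [slotStart_even] at hclaim hS hQ hSdiv hSlin hWk hRk hWkdiv hWklin
      rw [slotStart_even_succ] at hkT hS hQ hSdiv hSlin hWk hRk hWkdiv hWklin ⊢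
      obtain ⟨F, hF, hFper, hF0, heatF, hLeq, -⟩ := slot_split_H P hδ₀ hd hγ (hN j) hν hkT hL hq hlin hS hQ
        hSdiv hSlin hLdiv hclaim
      have hend := slot_end_H P hδ₀ hd hν (hg (2 * j) hk).1 (hg (2 * j) hk).2 (hrealH j hk) hF hFper hF0 heatF
        hWk hRk hWkdiv hWklin (hW0H j hk)
      rw [hLeq _ (right_mem_Icc.2 (by linarith [tHalf_pos j]))]
      funext x
      rw [Finset.sum_range_succ, hend]
    · -- V half-slot of phase `j`
      rw [slotStart_odd] at hclaim hS hQ hSdiv hSlin hWk hRk hWkdiv hWklin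
      rw [slotStart_odd_succ] at hkT hS hQ hSdiv hSlin hWk hRk hWkdiv hWklin ⊢
      obtain ⟨F, hF, hFper, hF0, heatF, hLeq, -⟩ := slot_split_V P hδ₀ hd hγ (hN j) hν hkT hL hq hlin hS hQ
        hSdiv hSlin hLdiv hclaim
      have hend := slot_end_V P hδ₀ hd hν (hg (2 * j + 1) hk).1 (hg (2 * j + 1) hk).2 (hrealV j hk) hF hFper hF0
        heatF hWk hRk hWkdiv hWklin (hW0V j hk)
      have hlt : tStart j + tHalf j < tStart (j + 1) := by rw [tStart_succ]; linarith [tHalf_pos j]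
      rw [hLeq _ (right_mem_Icc.2 hlt.le)]
      funext x
      conv_rhs => rw [Finset.sum_range_succ]
      rw [hend]


/-- **Slot-wise `L²` bound of the forced response.**  Under the hypotheses of `response_at_slotStart`, for
every slot `k < K` and every `t` in it:
`√∫‖L(t)‖² ≤ Σ_{i<k} √∫‖W i (t)‖² + 6√(2π) ν N_{k/2} γ / δ_{k/2}`. -/
theorem response_slot_bound (hδ₀ : 0 < P.δ₀) (hd : 0 < P.d) (hγ : 0 ≤ P.γ) (hN : ∀ j, P.N j ≠ 0)
    (hν : 0 < ν) (hK : CascadeParams.tInject (K / 2) (K % 2 == 0) ≤ T')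
    {L : ℝ → UnitAddTorus (Fin 2) → EuclideanSpace ℝ (Fin 2)} {q : ℝ → UnitAddTorus (Fin 2) → ℝ}
    (hL : Torus.IsSmoothSpaceTimeOn (Icc 0 T') L) (hq : Torus.IsSmoothSpaceTimeOn (Icc 0 T') q)
    (hLdiv : ∀ t ∈ Icc 0 T', Torus.IsDivFree (L t)) (hL0 : L 0 = fun _ => 0)
    (hlin : ∀ t ∈ Icc 0 T', ∀ x, Torus.timeDerivWithin (Icc 0 T') L t x + Torus.convect (P.field t) (L t) x +
      Torus.convect (L t) (P.field t) x =
        ν • Torus.laplacian (L t) x - Torus.gradient (q t) x + ν • Torus.laplacian (P.field t) x)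
    {g : ℕ → ℝ → ℝ} (hg : ∀ k < K, ContDiff ℝ ∞ (g k) ∧ Function.Periodic (g k) 1)
    (hrealH : ∀ j, 2 * j < K → ∀ c F : ℝ → ℝ → ℝ,
        ContDiffOn ℝ ∞ (Function.uncurry c) (Icc (tStart j) (tStart j + tHalf j) ×ˢ univ) →
        (∀ t ∈ Icc (tStart j) (tStart j + tHalf j), Function.Periodic (c t) 1) →
        (∀ t ∈ Icc (tStart j) (tStart j + tHalf j), ∀ y,
          derivWithin (fun s => c s y) (Icc (tStart j) (tStart j + tHalf j)) t = ν * deriv (deriv (c t)) y) →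
        c (tStart j) = g (2 * j) →
        ContDiffOn ℝ ∞ (Function.uncurry F) (Icc (tStart j) (tStart j + tHalf j) ×ˢ univ) →
        (∀ t ∈ Icc (tStart j) (tStart j + tHalf j), Function.Periodic (F t) 1) → F (tStart j) = (fun _ => 0) →
        (∀ t ∈ Icc (tStart j) (tStart j + tHalf j), ∀ y,
          derivWithin (fun s => F s y) (Icc (tStart j) (tStart j + tHalf j)) t =
            ν * deriv (deriv (F t)) y + ν * (P.rateH j t * deriv (deriv (P.U j)) y)) →
        c (tStart j + tHalf j) = F (tStart j + tHalf j))
    (hrealV : ∀ j, 2 * j + 1 < K → ∀ c F : ℝ → ℝ → ℝ,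
        ContDiffOn ℝ ∞ (Function.uncurry c) (Icc (tStart j + tHalf j) (tStart (j + 1)) ×ˢ univ) →
        (∀ t ∈ Icc (tStart j + tHalf j) (tStart (j + 1)), Function.Periodic (c t) 1) →
        (∀ t ∈ Icc (tStart j + tHalf j) (tStart (j + 1)), ∀ y,
          derivWithin (fun s => c s y) (Icc (tStart j + tHalf j) (tStart (j + 1))) t = ν * deriv (deriv (c t)) y) →
        c (tStart j + tHalf j) = g (2 * j + 1) →
        ContDiffOn ℝ ∞ (Function.uncurry F) (Icc (tStart j + tHalf j) (tStart (j + 1)) ×ˢ univ) →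
        (∀ t ∈ Icc (tStart j + tHalf j) (tStart (j + 1)), Function.Periodic (F t) 1) →
        F (tStart j + tHalf j) = (fun _ => 0) →
        (∀ t ∈ Icc (tStart j + tHalf j) (tStart (j + 1)), ∀ y,
          derivWithin (fun s => F s y) (Icc (tStart j + tHalf j) (tStart (j + 1))) t =
            ν * deriv (deriv (F t)) y + ν * (P.rateV j t * deriv (deriv (P.U j)) y)) →
        c (tStart (j + 1)) = F (tStart (j + 1)))
    (hW : ∀ i < K, Torus.IsSmoothSpaceTimeOn (Icc (CascadeParams.tInject (i / 2) (i % 2 == 0)) T') (W i))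
    (hR : ∀ i < K, Torus.IsSmoothSpaceTimeOn (Icc (CascadeParams.tInject (i / 2) (i % 2 == 0)) T') (R i))
    (hWdiv : ∀ i < K, ∀ t ∈ Icc (CascadeParams.tInject (i / 2) (i % 2 == 0)) T', Torus.IsDivFree (W i t))
    (hWlin : ∀ i < K, ∀ t ∈ Icc (CascadeParams.tInject (i / 2) (i % 2 == 0)) T', ∀ x,
      Torus.timeDerivWithin (Icc (CascadeParams.tInject (i / 2) (i % 2 == 0)) T') (W i) t x +
        Torus.convect (P.field t) (W i t) x + Torus.convect (W i t) (P.field t) x =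
          ν • Torus.laplacian (W i t) x - Torus.gradient (R i t) x)
    (hW0H : ∀ j, 2 * j < K → W (2 * j) (tStart j) =
      fun x => g (2 * j) (Torus.repr x 1) • EuclideanSpace.single (0 : Fin 2) (1 : ℝ))
    (hW0V : ∀ j, 2 * j + 1 < K → W (2 * j + 1) (tStart j + tHalf j) =
      fun x => g (2 * j + 1) (Torus.repr x 0) • EuclideanSpace.single (1 : Fin 2) (1 : ℝ))
    {k : ℕ} (hk : k < K) {t : ℝ}
    (ht : t ∈ Icc (CascadeParams.tInject (k / 2) (k % 2 == 0)) (CascadeParams.tInject ((k + 1) / 2) ((k + 1) % 2 == 0))) :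
    Real.sqrt (Torus.vectorL2Sq (L t)) ≤
      ∑ i ∈ Finset.range k, Real.sqrt (Torus.vectorL2Sq (W i t)) +
        6 * Real.sqrt (2 * Real.pi) * ν * (P.N (k / 2)) * P.γ / P.δ (k / 2) := by
  have hkT : CascadeParams.tInject ((k + 1) / 2) ((k + 1) % 2 == 0) ≤ T' := (slotStart_mono (Nat.succ_le_of_lt hk)).trans hK
  have hclaim := response_at_slotStart P hδ₀ hd hγ hN hν hK hL hq hLdiv hL0 hlin hg hrealH hrealV hW hR hWdiv hWlin
    hW0H hW0V k hk.le
  obtain ⟨hS, hQ, hSdiv, hSlin⟩ := partialSum_linearisedNS P hW hR hWdiv hWlin hk hkT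
  -- continuity of the pieces at time `t`
  have hti : ∀ i ∈ Finset.range k, t ∈ Icc (CascadeParams.tInject (i / 2) (i % 2 == 0)) T' := fun i hi =>
    ⟨(slotStart_mono (Finset.mem_range.1 hi).le).trans ht.1, ht.2.trans hkT⟩
  have hcont : ∀ i ∈ Finset.range k, Continuous (W i t) := fun i hi =>
    ((hW i ((Finset.mem_range.1 hi).trans hk)).isSmooth_slice (hti i hi)).continuous
  have hScont : Continuous (fun x => ∑ i ∈ Finset.range k, W i t x) := continuous_finsetSum _ fun i hi => hcont i hi
  have htri : ∀ {B : ℝ}, Real.sqrt (Torus.vectorL2Sq (fun x => L t x - ∑ i ∈ Finset.range k, W i t x)) ≤ B →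
      Real.sqrt (Torus.vectorL2Sq (L t)) ≤ ∑ i ∈ Finset.range k, Real.sqrt (Torus.vectorL2Sq (W i t)) + B := by
    intro B hB
    have hLt : Continuous (L t) := (hL.isSmooth_slice ⟨(slotStart_nonneg k).trans ht.1, ht.2.trans hkT⟩).continuous
    have hdiff : Continuous (fun x => L t x - ∑ i ∈ Finset.range k, W i t x) := hLt.sub hScont
    have heq : L t = fun x => (∑ i ∈ Finset.range k, W i t x) + (L t x - ∑ i ∈ Finset.range k, W i t x) := by
      funext x; abel
    calc Real.sqrt (Torus.vectorL2Sq (L t))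
        = Real.sqrt (Torus.vectorL2Sq (fun x => (∑ i ∈ Finset.range k, W i t x) + (L t x - ∑ i ∈ Finset.range k, W i t x))) := by
          rw [← heq]
      _ ≤ Real.sqrt (Torus.vectorL2Sq (fun x => ∑ i ∈ Finset.range k, W i t x)) +
            Real.sqrt (Torus.vectorL2Sq (fun x => L t x - ∑ i ∈ Finset.range k, W i t x)) :=
          sqrt_vectorL2Sq_add_le hScont hdiff
      _ ≤ ∑ i ∈ Finset.range k, Real.sqrt (Torus.vectorL2Sq (W i t)) + B :=
          add_le_add (sqrt_vectorL2Sq_sum_le _ hcont) hB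
  obtain ⟨j, rfl | rfl⟩ := Nat.even_or_odd' k
  · rw [slotStart_even] at hclaim hS hQ hSdiv hSlin ht
    rw [slotStart_even_succ] at hkT hS hQ hSdiv hSlin ht
    obtain ⟨F, -, -, -, -, -, hbd⟩ := slot_split_H P hδ₀ hd hγ (hN j) hν hkT hL hq hlin hS hQ hSdiv hSlin hLdiv hclaim
    rw [show 2 * j / 2 = j by omega]
    exact htri (hbd t ht)
  · rw [slotStart_odd] at hclaim hS hQ hSdiv hSlin ht
    rw [slotStart_odd_succ] at hkT hS hQ hSdiv hSlin ht
    obtain ⟨F, -, -, -, -, -, hbd⟩ := slot_split_V P hδ₀ hd hγ (hN j) hν hkT hL hq hlin hS hQ hSdiv hSlin hLdiv hclaim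
    rw [show (2 * j + 1) / 2 = j by omega]
    exact htri (hbd t ht)

end Duhamel

end Summit.AnomalousDissipation.AnomalousDissipation.Theorems.SawtoothPulseCascade.ApproxResponse

end
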